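import Summits.QuantumFields.YangMills.Theorems.TransportPerturbationSynchronousShadowFineWindowIdentityOfGibbsInvariance
import Summits.QuantumFields.YangMills.Theorems.TransportPerturbationGibbsInvariance
import HarnessLib

/-!
# Route `TransportPerturbation`, LINE 16 «synchronous_shadow» (crux K2 `WeightedAlmostInvariance`, stmt-QuantumFields-26987;
# item `RegularWindowShadow`, stmt-QuantumFields-27784): the registered stub `stub_fineWindowIdentity` LANDED

Seat `ym-line-csu-p1`, g8.  The shared stub `stub_fineWindowIdentity` (M) of the registered skeleton `SynchronousShadow` is the route
item `GibbsInvariance` (stmt-QuantumFields-26921) tested on `g ∘ descend` (`stub_fineWindowIdentity_of_gibbsInvariance`, seat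
`ym-line-sfw-p2-w5` g9); `GibbsInvariance` is now PROVED (`Theorems.TransportPerturbation.GibbsInvariance_proof`, from the tree theorem
`ColdStartUniversality.wilsonMeasureLangevinInvariant_su2` = SZZ Lemma 3.3 for `SU(2)`, `d = 3`, all couplings), so the stub closes by
name and signature.  HONEST FRAMING: the load-bearing stub `stub_synchronousCoupling` (XL) is untouched; no crux, rung or summit is
proved here; the Yang–Mills mass gap is NOT proved (R3 is a RECORD rung).  No definition, no sorry.
-/

set_option autoImplicit false

noncomputable section

namespace Summit.QuantumFields.YangMills.Cruxes.WeightedAlmostInvariance.SynchronousShadow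

/-- **The registered stub `stub_fineWindowIdentity`** (fine-window identity: Gibbs_{K+1}-invariance of the step-`(K+1)` SZZ
dynamics on `g ∘ descend`), by name and signature. [cite: ShenZhuZhu2022, §3 Lemma 3.3 (p. 13)] -/
theorem stub_fineWindowIdentity : __Registered.stub_fineWindowIdentity :=
  stub_fineWindowIdentity_of_gibbsInvariance Summit.QuantumFields.YangMills.Theorems.TransportPerturbation.GibbsInvariance_proof

end Summit.QuantumFields.YangMills.Cruxes.WeightedAlmostInvariance.SynchronousShadow

end
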